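import Mathlib
import Summits.Ventures.HodgeRepro.OcticCMPointEightNormClass

/-!
# OcticCMPointEightOddConductor — at the ramified places a conjugate-dual character never has odd conductor `3`, `5`, `7`

Blind re-derivation cell `pub-hodge-repro`, seat night-2 (gen 5).  Target tree path
`lean/Summits/Ventures/HodgeRepro/OcticCMPointEightOddConductor.lean`.  On `R8 = 𝒪/𝔭⁸` at `𝔭 | 5`, a conjugate-dual
character `ρ` (`ρ ∘ σ = ρ⁻¹`) is trivial on norms (`conjDual_norm`), and **`1 + t ϖ^{2m} ≡ N(1 + (t/2) ϖ^{2m})`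
modulo `𝔭^{2m+1}`** because `ϖ^{2m}` is `σ`-fixed: explicitly
`1 + w² s ≡ N(1 + 3 s₀ w²) mod (w³)`, `1 + 5 s ≡ N(1 + 15 s₀) mod (5w) = (w⁵)`, `1 + 5 w² s ≡ N(1 + 15 s₀ w²) mod (5w³) = (w⁷)`
(`s₀` the constant coordinate of `s`; `2 · 3 = 6 ≡ 1 mod 5`).  Hence a conjugate-dual `ρ` trivial on `1 + 𝔭^{2m+1}` is
trivial on `1 + 𝔭^{2m}` (`conjDual_trivial_w_sq_of_w_cube`, `conjDual_trivial_five_of_five_w`,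
`conjDual_trivial_five_w_sq_of_five_w_cube`): **no conjugate-dual character of `(𝒪/𝔭⁸)^×` has conductor `3`, `5` or `7`**
(`conjDual_conductor_ne_odd`).  With gen 4's `c = 1, 2`, gen 5's `c = 4, 6, 8` (`OcticCMPointS3SignsRamifiedEven`) the
table of conjugate-dual root numbers at `𝔭 | 5` is COMPLETE for every conductor `≤ 8` — the "odd rows" at the ramified
places are empty, not open.  (Numerically, numerics/conjdual_exists.py: conjugate-dual characters of conductor exactly
`c` exist for `c ∈ {1, 2, 4, 6, 8}` and for no odd `c ≥ 3`; at the inert place `𝔮` the odd conductors DO occur.)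

**What this is not.**  Conductors `> 8` are not modelled; the inert place's odd conductors (`c = 3, 5, …` at `𝔮`) remain
open.  Nothing here says anything about the status of the Hodge conjecture for CM abelian varieties, which is NOT proved.
-/

set_option autoImplicit false

noncomputable section

open Polynomial Classical

namespace Summit.Ventures.HodgeRepro.PeriodCloser

namespace EightModel

open GaussSumStability SixModel

/-- The constant coordinate of `s`, as an element of `R8`. -/
def const (s : R8) : R8 := algebraMap (ZMod 25) R8 (b4.repr s 0)

/-- `s − const s ∈ (w)`. -/
theorem sub_const_eq (s : R8) : s - const s = w * (algebraMap (ZMod 25) R8 (b4.repr s 1) +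
    algebraMap (ZMod 25) R8 (b4.repr s 2) * w + algebraMap (ZMod 25) R8 (b4.repr s 3) * w ^ 2) := by
  unfold const
  have hcomb := eq_comb s
  simp only [smul_eq_num] at hcomb
  linear_combination hcomb

/-- `σ` fixes `const s`. -/
theorem conj_const (s : R8) : conj (const s) = const s := by
  unfold const
  exact AlgHom.commutes _ _

/-- `1 + w² y` is a unit (`(w² y)⁴ = w⁸ y⁴ = 0`). -/
theorem isUnit_one_add_w_sq_mul (y : R8) : IsUnit (1 + w ^ 2 * y) := by
  have h8 := w_pow_eight
  refine IsUnit.of_mul_eq_one (1 - w ^ 2 * y + (w ^ 2 * y) ^ 2 - (w ^ 2 * y) ^ 3) ?_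
  linear_combination (-(y ^ 4)) * h8

/-- **Conductor `5` is impossible**: a conjugate-dual `ρ` trivial on `1 + (5w)` is trivial on `1 + 5R8`:
`1 + 5s = N(1 + 15 s₀) · (1 + z')` with `z' ∈ (5w)`. -/
theorem conjDual_trivial_five_of_five_w (ρ : LocalChar R8) (hσ : ∀ x, ρ.unit (conj x) = ρ.unit⁻¹ x)
    (h : ∀ y, ρ.unit (1 + 5 * w * y) = 1) (s : R8) : ρ.unit (1 + 5 * s) = 1 := by
  set s₀ := const s with hs₀
  have h25 := twentyfive_eq_zero
  -- the unit `v = 1 + 15 s₀` is `σ`-fixed and `N(v) = v² = 1 + 5 s₀`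
  have hv : IsUnit (1 + 15 * s₀) := IsUnit.of_mul_eq_one (1 - 15 * s₀) (by linear_combination (-(9 * s₀ ^ 2)) * h25)
  have hN : (1 + 15 * s₀) * conj (1 + 15 * s₀) = 1 + 5 * s₀ := by
    rw [map_add, map_one, map_mul, map_ofNat, conj_const]
    linear_combination (9 * s₀ ^ 2 + s₀) * h25
  -- `1 + 5 s = (1 + 5 s₀) (1 + 5 w y')` with `y' = (1 − 5 s₀) · (the `w`-part of `s`)`
  obtain ⟨y, hy⟩ : ∃ y, s - s₀ = w * y := ⟨_, sub_const_eq s⟩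
  have hinv : (1 + 5 * s₀) * (1 - 5 * s₀) = 1 := by linear_combination (-(s₀ ^ 2)) * h25
  have hfac : 1 + 5 * s = (1 + 5 * s₀) * (1 + 5 * w * ((1 - 5 * s₀) * y)) := by
    linear_combination 5 * hy + (5 * w * y * s₀ ^ 2) * h25
  rw [hfac, map_mul, h, mul_one, ← hN]
  have := conjDual_norm ρ hσ hv.unit
  rw [IsUnit.unit_spec] at this
  exact this

/-- **Conductor `7` is impossible**: a conjugate-dual `ρ` trivial on `1 + (5w³)` is trivial on `1 + (5w²)`:
`1 + 5w² s = N(1 + 15 s₀ w²) · (1 + z')` with `z' ∈ (5w³)`. -/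
theorem conjDual_trivial_five_w_sq_of_five_w_cube (ρ : LocalChar R8) (hσ : ∀ x, ρ.unit (conj x) = ρ.unit⁻¹ x)
    (h : ∀ y, ρ.unit (1 + 5 * w ^ 3 * y) = 1) (s : R8) : ρ.unit (1 + 5 * w ^ 2 * s) = 1 := by
  set s₀ := const s with hs₀
  have h25 := twentyfive_eq_zero
  have hv : IsUnit (1 + 15 * s₀ * w ^ 2) :=
    IsUnit.of_mul_eq_one (1 - 15 * s₀ * w ^ 2) (by linear_combination (-(9 * s₀ ^ 2 * w ^ 4)) * h25)
  have hN : (1 + 15 * s₀ * w ^ 2) * conj (1 + 15 * s₀ * w ^ 2) = 1 + 5 * s₀ * w ^ 2 := by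
    rw [map_add, map_one, map_mul, map_mul, map_ofNat, conj_const, map_pow, conj_w, neg_sq]
    linear_combination (9 * s₀ ^ 2 * w ^ 4 + s₀ * w ^ 2) * h25
  obtain ⟨y, hy⟩ : ∃ y, s - s₀ = w * y := ⟨_, sub_const_eq s⟩
  have hinv : (1 + 5 * s₀ * w ^ 2) * (1 - 5 * s₀ * w ^ 2) = 1 := by
    linear_combination (-(s₀ ^ 2 * w ^ 4)) * h25
  have hfac : 1 + 5 * w ^ 2 * s = (1 + 5 * s₀ * w ^ 2) * (1 + 5 * w ^ 3 * ((1 - 5 * s₀ * w ^ 2) * y)) := by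
    linear_combination (5 * w ^ 2) * hy + (5 * w ^ 7 * y * s₀ ^ 2) * h25
  rw [hfac, map_mul, h, mul_one, ← hN]
  have := conjDual_norm ρ hσ hv.unit
  rw [IsUnit.unit_spec] at this
  exact this

/-- **Conductor `3` is impossible**: a conjugate-dual `ρ` trivial on `1 + (w³)` is trivial on `1 + (w²)`:
`1 + w² s = N(1 + 3 s₀ w²) · (1 + z')` with `z' ∈ (w³)` (using `5 = w³(w³ − w)`). -/
theorem conjDual_trivial_w_sq_of_w_cube (ρ : LocalChar R8) (hσ : ∀ x, ρ.unit (conj x) = ρ.unit⁻¹ x)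
    (h : ∀ y, ρ.unit (1 + w ^ 3 * y) = 1) (s : R8) : ρ.unit (1 + w ^ 2 * s) = 1 := by
  set s₀ := const s with hs₀
  have h5 := five_eq
  have h8 := w_pow_eight
  -- `N(v) = v² = 1 + w² (6 s₀ + 9 s₀² w²)`, a unit
  set x := w ^ 2 * (6 * s₀ + 9 * s₀ ^ 2 * w ^ 2) with hx
  have hv : IsUnit (1 + 3 * s₀ * w ^ 2) :=
    IsUnit.of_mul_eq_one (1 - 3 * s₀ * w ^ 2 + 9 * s₀ ^ 2 * w ^ 4 - 27 * s₀ ^ 3 * w ^ 6)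
      (by linear_combination (-(81 * s₀ ^ 4)) * h8)
  have hN : (1 + 3 * s₀ * w ^ 2) * conj (1 + 3 * s₀ * w ^ 2) = 1 + x := by
    rw [map_add, map_one, map_mul, map_mul, map_ofNat, conj_const, map_pow, conj_w, neg_sq, hx]
    ring
  have hinv : (1 + x) * (1 - x + x ^ 2 - x ^ 3) = 1 := by
    rw [hx]
    linear_combination (-((6 * s₀ + 9 * s₀ ^ 2 * w ^ 2) ^ 4)) * h8
  obtain ⟨y, hy⟩ : ∃ y, s - s₀ = w * y := ⟨_, sub_const_eq s⟩
  set Y := y - w ^ 2 * (w ^ 3 - w) * s₀ - 9 * s₀ ^ 2 * w with hY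
  have hfac : 1 + w ^ 2 * s = (1 + x) * (1 + w ^ 3 * ((1 - x + x ^ 2 - x ^ 3) * Y)) := by
    rw [hx, hY]
    linear_combination w ^ 2 * hy - (w ^ 3 * (y - w ^ 2 * (w ^ 3 - w) * s₀ - 9 * s₀ ^ 2 * w)) * hinv -
      (s₀ * w ^ 2) * h5
  rw [hfac, map_mul, h, mul_one, ← hN]
  have := conjDual_norm ρ hσ hv.unit
  rw [IsUnit.unit_spec] at this
  exact this

/-- **A conjugate-dual character of `(𝒪/𝔭⁸)^×` has no odd conductor `3`, `5`, `7`**: trivial on `1 + 𝔭^{c}`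
(`c = 3, 5, 7`, i.e. `1 + (w³)`, `1 + (5w)`, `1 + (5w³)`) forces trivial on `1 + 𝔭^{c−1}` (`1 + (w²)`, `1 + 5R8`,
`1 + (5w²)`). -/
theorem conjDual_conductor_ne_odd (ρ : LocalChar R8) (hσ : ∀ x, ρ.unit (conj x) = ρ.unit⁻¹ x) :
    ((∀ y, ρ.unit (1 + w ^ 3 * y) = 1) → ∀ s, ρ.unit (1 + w ^ 2 * s) = 1) ∧
    ((∀ y, ρ.unit (1 + 5 * w * y) = 1) → ∀ s, ρ.unit (1 + 5 * s) = 1) ∧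
    ((∀ y, ρ.unit (1 + 5 * w ^ 3 * y) = 1) → ∀ s, ρ.unit (1 + 5 * w ^ 2 * s) = 1) :=
  ⟨fun h s => conjDual_trivial_w_sq_of_w_cube ρ hσ h s,
    fun h s => conjDual_trivial_five_of_five_w ρ hσ h s,
    fun h s => conjDual_trivial_five_w_sq_of_five_w_cube ρ hσ h s⟩

end EightModel

end Summit.Ventures.HodgeRepro.PeriodCloser

end
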